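import Summits.Ventures.YMGap.RobustBall.CentreTubeWindowMembers
import Summits.Ventures.YMGap.RobustBall.StringTensionCentreBlind
import HarnessLib

/-!
# Robust ball (Y2) — STRING TENSION ON THE WINDOWED CENTRE TUBE: the infinite-volume form of `AreaLawCentreTubeW`

HONEST FRAMING: venture file of the cell `pub-ymgap` (QuantumFields programme), track ROBUST-BALL / DS seat ds-4 (g8).
Strong-coupling LATTICE statements; centre-projected `ℤ_N` flux picture; nothing about the continuum, a spectral mass gap, or Clay.

WHAT.  `CentreTubeWindow` proves the torus area law `AreaLawCentreTubeW N d β m s b` (`N ≥ 2`, `0 < m`, `0 < s`,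
`2(d−1)N|β| + b < 1`; `(C, c) = (2, −log max(2(d−1)N|β| + b, 1/2)/(m s))`) for EVERY torus and EVERY perturbation whose twist defect is a
finite-range flux interaction (`IsFluxLocalW m s b`).  As in gen 7's file 12 / gen 8's `StringTensionCentreTube` (schema = rb-p2's
`hasAreaLawWith_of_torusBound` verbatim), the volume-uniform bound passes to every INFINITE-VOLUME LIMIT STATE of every family that is
eventually `IsFluxLocalW m s b`, in the tree's `ℤ^d` currencies:
* `hasAreaLawWith_centreTubeW` / `stringTension_centreTubeW` — from the currency (`d ≥ 2`): `HasAreaLawWith μ χ_N C c`, `HasAreaLawState`,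
  `σ ≥ c` WHENEVER the string tension exists, `IsConfining` given existence;
* `stringTension_fluxLocalW` — unconditionally with the explicit constants;
* ★ `stringTension_rectangleAction` — Wilson + ANY twist-blind action + p1's `1×2`-RECTANGLE (Symanzik) action of size `τ`: one rate
  `c = −log max(2(d−1)N|β| + 25 d(d−1)|τ|, 1/2)/4` for every such family and every limit state; such families EXIST
  (`exists_rectangleAction_family`, non-empty limit points) — a nonzero-`N`-ality, two-plaquette member family.
WHAT IS NOT CLAIMED.  EXISTENCE of the string tension of a limit state of a perturbed family; every string-tension clause is «whenever it
exists»; the unconditional content is `HasAreaLawWith` of every limit state.  Window smaller than tier 1's; tube open only for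
finite-range, vertically windowed flux defects; the rate is a door artefact (Seiler ceiling applies).

References (mechanism, AS PRINTED): J. Fröhlich, Phys. Lett. B 83 (1979) 195–198 [Frohlich1979ZN]; G. Mack, V. B. Petkova,
Ann. Phys. 123 (1979) 442–467 [MackPetkova1979]; B. Durhuus, J. Fröhlich, Comm. Math. Phys. 75 (1980) 103; E. Seiler, LNP 159 (1982) §2.
-/

noncomputable section

open MeasureTheory Filter Topology
open Literature.MathematicalPhysics.QuantumLattice
open Literature.MathematicalPhysics.QuantumFieldTheory hiding ZdEdge Site
open Literature.Barriers.QuantumFields (suFundStringTension suFundStringTension_def)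

namespace Summit.Ventures.YMGap.RobustBall

open ZNFluxW

variable {d L N : ℕ}

/-! ### From the currency `AreaLawCentreTubeW` -/

/-- **WINDOWED CENTRE-TUBE AREA LAW ⇒ `ℤ^d` AREA LAW OF EVERY LIMIT STATE, SAME CONSTANTS** (`d ≥ 2`). [folklore] -/
theorem hasAreaLawWith_centreTubeW [NeZero d] [NeZero N] (hd : 2 ≤ d) {β b : ℝ} {m s : ℕ} (h : AreaLawCentreTubeW N d β m s b) :
    ∃ C c : ℝ, 0 < c ∧ ∀ 𝓦 : PerturbationFamily d N,
      (∀ᶠ L : ℕ in atTop, IsFluxLocalW m s b (𝓦 L)) →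
        ∀ μ ∈ perturbedLimitPoints β 𝓦,
          HasAreaLawWith μ (fun g => normalisedCharacter N (fundamentalRep (Fin N) g)) C c := by
  obtain ⟨C, c, hc, hA⟩ := h
  refine ⟨C, c, hc, fun 𝓦 h𝓦 μ hμ => hasAreaLawWith_of_torusBound (β := β)
    (fun L => {W : Perturbation d (L + 1) N | IsFluxLocalW m s b W}) (fun L W hW R T hR hT hRL hTL => ?_) 𝓦
    (h𝓦.mono fun L hL => hL) hμ⟩
  exact hA (L + 1) W hW 0 0 1 R T (fin_zero_ne_one_of_two_le hd) hR hT hRL hTL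

/-- **STRING TENSION ON THE WINDOWED CENTRE TUBE.**  Under `AreaLawCentreTubeW N d β m s b` (`d ≥ 2`): ONE pair `(C, c)`, `c > 0`, such
that every infinite-volume limit state `μ` of every eventually-`IsFluxLocalW m s b` family obeys `HasAreaLawWith μ χ_N C c`,
`HasAreaLawState`, `σ ≥ c` whenever its string tension exists, and `IsConfining` given existence. [folklore] -/
theorem stringTension_centreTubeW [NeZero d] [NeZero N] (hd : 2 ≤ d) {β b : ℝ} {m s : ℕ} (h : AreaLawCentreTubeW N d β m s b) :
    ∃ C c : ℝ, 0 < c ∧ ∀ 𝓦 : PerturbationFamily d N,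
      (∀ᶠ L : ℕ in atTop, IsFluxLocalW m s b (𝓦 L)) →
        ∀ μ ∈ perturbedLimitPoints β 𝓦,
          HasAreaLawWith μ (fun g => normalisedCharacter N (fundamentalRep (Fin N) g)) C c ∧
          HasAreaLawState μ (fun g => normalisedCharacter N (fundamentalRep (Fin N) g)) ∧
          (∀ σ : ℝ, HasStringTension μ (fun g => normalisedCharacter N (fundamentalRep (Fin N) g)) σ → c ≤ σ) ∧
          ((∃ σ : ℝ, HasStringTension μ (fun g => normalisedCharacter N (fundamentalRep (Fin N) g)) σ) →
            IsConfining μ (fun g => normalisedCharacter N (fundamentalRep (Fin N) g))) := by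
  obtain ⟨C, c, hc, hA⟩ := hasAreaLawWith_centreTubeW hd h
  refine ⟨C, c, hc, fun 𝓦 h𝓦 μ hμ => ?_⟩
  have hW := hA 𝓦 h𝓦 μ hμ
  exact ⟨hW, ⟨C, c, hc, hW⟩, fun σ hσ => hW.le_of_hasStringTension hσ,
    fun hσ => HasAreaLawState.isConfining ⟨C, c, hc, hW⟩ hσ⟩

/-! ### Unconditionally, with the explicit constants -/

/-- **STRING TENSION OF WINDOWED FLUX-LOCAL FAMILIES, explicit constants** (`N ≥ 2`, `d ≥ 2`, `0 < m`, `0 < s`,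
`c₀ = 2(d−1)N|β| + b < 1`; `C = 2`, `c = −log max(c₀, 1/2)/(m s) > 0`). [folklore] -/
theorem stringTension_fluxLocalW [NeZero d] [NeZero N] (hd : 2 ≤ d) (hN : 2 ≤ N) {β b : ℝ} {m s : ℕ} (hm : 0 < m) (hs : 0 < s)
    (hβ : 2 * ((d - 1 : ℕ) : ℝ) * |β| * N + b < 1) :
    ∀ 𝓦 : PerturbationFamily d N, (∀ᶠ L : ℕ in atTop, IsFluxLocalW m s b (𝓦 L)) →
      ∀ μ ∈ perturbedLimitPoints β 𝓦,
        HasAreaLawWith μ (fun g => normalisedCharacter N (fundamentalRep (Fin N) g)) 2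
            (-Real.log (max (2 * ((d - 1 : ℕ) : ℝ) * |β| * N + b) (1 / 2)) / (m * s)) ∧
        (∀ σ : ℝ, HasStringTension μ (fun g => normalisedCharacter N (fundamentalRep (Fin N) g)) σ →
            -Real.log (max (2 * ((d - 1 : ℕ) : ℝ) * |β| * N + b) (1 / 2)) / (m * s) ≤ σ) ∧
        ((∃ σ : ℝ, HasStringTension μ (fun g => normalisedCharacter N (fundamentalRep (Fin N) g)) σ) →
            IsConfining μ (fun g => normalisedCharacter N (fundamentalRep (Fin N) g))) := by
  set c := max (2 * ((d - 1 : ℕ) : ℝ) * |β| * N + b) (1 / 2) with hcdef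
  have hc0 : 0 < c := lt_max_of_lt_right (by norm_num)
  have hc1 : c < 1 := max_lt hβ (by norm_num)
  have hcle : 2 * ((d - 1 : ℕ) : ℝ) * |β| * N + b ≤ c := le_max_left _ _
  have hpos : 0 < -Real.log c / (m * s) := div_pos (neg_pos.2 (Real.log_neg hc0 hc1)) (by positivity)
  intro 𝓦 h𝓦 μ hμ
  have hW : HasAreaLawWith μ (fun g => normalisedCharacter N (fundamentalRep (Fin N) g)) 2 (-Real.log c / (m * s)) :=
    hasAreaLawWith_of_torusBound (β := β) (fun L => {W : Perturbation d (L + 1) N | IsFluxLocalW m s b W})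
      (fun L W hW R T _ _ hRL hTL =>
        (abs_wilsonLoop_le_of_isFluxLocalW hN hm hs hcle hc1.le W hW 0 (fin_zero_ne_one_of_two_le hd) hRL hTL).trans
          (windowBound_le_areaLawShape hc0 hc1.le hm hs R T))
      𝓦 (h𝓦.mono fun L hL => hL) hμ
  exact ⟨hW, fun σ hσ => hW.le_of_hasStringTension hσ,
    fun hσ => HasAreaLawState.isConfining ⟨2, -Real.log c / (m * s), hpos, hW⟩ hσ⟩

/-! ### The `1×2`-rectangle (Symanzik) families -/

/-- **STRING TENSION WITH THE `1×2`-RECTANGLE TERM** (`N ≥ 2`, `d ≥ 2`, `c₀ = 2(d−1)N|β| + 25 d(d−1)|τ| < 1`,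
`c = −log max(c₀, 1/2)/4`): every infinite-volume limit state of every family whose member at each large torus size is a twist-blind action
(ANY size) plus p1's `1×2`-rectangle action of size `τ` obeys `HasAreaLawWith μ χ_N 2 c` and `σ ≥ c` whenever its string tension exists.
[folklore] -/
theorem stringTension_rectangleAction [NeZero d] [NeZero N] (hd : 2 ≤ d) (hN : 2 ≤ N) {β τ : ℝ}
    (hβ : 2 * ((d - 1 : ℕ) : ℝ) * |β| * N + 25 * ((d : ℝ) * ((d : ℝ) - 1)) * |τ| < 1) :
    ∀ 𝓦 : PerturbationFamily d N,
      (∀ᶠ L : ℕ in atTop, ∃ Wb : Perturbation d (L + 1) N,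
        IsTwistBlind Wb ∧ 𝓦 L = Wb + termPerturbation (rectFamily d (L + 1) N τ)) →
      ∀ μ ∈ perturbedLimitPoints β 𝓦,
        HasAreaLawWith μ (fun g => normalisedCharacter N (fundamentalRep (Fin N) g)) 2
            (-Real.log (max (2 * ((d - 1 : ℕ) : ℝ) * |β| * N + 25 * ((d : ℝ) * ((d : ℝ) - 1)) * |τ|) (1 / 2)) / ((2 : ℕ) * (2 : ℕ))) ∧
        (∀ σ : ℝ, HasStringTension μ (fun g => normalisedCharacter N (fundamentalRep (Fin N) g)) σ →
            -Real.log (max (2 * ((d - 1 : ℕ) : ℝ) * |β| * N + 25 * ((d : ℝ) * ((d : ℝ) - 1)) * |τ|) (1 / 2)) / ((2 : ℕ) * (2 : ℕ)) ≤ σ) := by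
  intro 𝓦 h𝓦 μ hμ
  have h := stringTension_fluxLocalW hd hN (m := 2) (s := 2) (by norm_num) (by norm_num) hβ 𝓦 (h𝓦.mono fun L hL => ?_) μ hμ
  · exact ⟨h.1, h.2.1⟩
  · obtain ⟨Wb, hb, hL⟩ := hL
    rw [hL]
    exact isFluxLocalW_twistBlind_add_rectFamily τ hb

/-- **Rectangle families with a twist-blind background EXIST and have confining limit states** (`N ≥ 2`, `d ≥ 2`,
`2(d−1)N|β| + 25 d(d−1)|τ| < 1`): for every sequence of twist-blind members `Wb^{(L)}` the family `Wb^{(L)} + W_rect(τ)` has a non-empty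
set of limit states, all obeying `HasAreaLawWith μ χ_N 2 c` with `c = −log max(c₀, 1/2)/4 > 0`. [folklore] -/
theorem exists_rectangleAction_family_confining [NeZero d] [NeZero N] (hd : 2 ≤ d) (hN : 2 ≤ N) {β τ : ℝ}
    (hβ : 2 * ((d - 1 : ℕ) : ℝ) * |β| * N + 25 * ((d : ℝ) * ((d : ℝ) - 1)) * |τ| < 1) (Wb : PerturbationFamily d N)
    (hb : ∀ L, IsTwistBlind (Wb L)) :
    ∃ 𝓦 : PerturbationFamily d N,
      (∀ L, 𝓦 L = Wb L + termPerturbation (rectFamily d (L + 1) N τ)) ∧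
      (perturbedLimitPoints β 𝓦).Nonempty ∧
      0 < -Real.log (max (2 * ((d - 1 : ℕ) : ℝ) * |β| * N + 25 * ((d : ℝ) * ((d : ℝ) - 1)) * |τ|) (1 / 2)) / ((2 : ℕ) * (2 : ℕ)) ∧
      ∀ μ ∈ perturbedLimitPoints β 𝓦,
        HasAreaLawWith μ (fun g => normalisedCharacter N (fundamentalRep (Fin N) g)) 2
            (-Real.log (max (2 * ((d - 1 : ℕ) : ℝ) * |β| * N + 25 * ((d : ℝ) * ((d : ℝ) - 1)) * |τ|) (1 / 2)) / ((2 : ℕ) * (2 : ℕ))) := by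
  have hc0 : 0 < max (2 * ((d - 1 : ℕ) : ℝ) * |β| * N + 25 * ((d : ℝ) * ((d : ℝ) - 1)) * |τ|) (1 / 2) :=
    lt_max_of_lt_right (by norm_num)
  have hc1 : max (2 * ((d - 1 : ℕ) : ℝ) * |β| * N + 25 * ((d : ℝ) * ((d : ℝ) - 1)) * |τ|) (1 / 2) < 1 := max_lt hβ (by norm_num)
  refine ⟨fun L => Wb L + termPerturbation (rectFamily d (L + 1) N τ), fun L => rfl, perturbedLimitPoints_nonempty β _,
    div_pos (neg_pos.2 (Real.log_neg hc0 hc1)) (by positivity), fun μ hμ => ?_⟩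
  exact (stringTension_rectangleAction hd hN hβ _ (Filter.Eventually.of_forall fun L => ⟨Wb L, hb L, rfl⟩) μ hμ).1

/-! ### Rows -/

/-- **SU(2), `d = 4`, `6 β_W + b < 1`**: every limit state of every eventually-`IsFluxLocalW m s b` family obeys
`HasAreaLawWith μ χ₂ 2 c`, `c = −log max(6 β_W + b, 1/2)/(m s)`, and `c ≤ suFundStringTension 2 μ` whenever the string tension exists.
[folklore] -/
theorem su2_stringTension_fluxLocalW_dim4 {β b : ℝ} {m s : ℕ} (hm : 0 < m) (hs : 0 < s) (hβ : 6 * (2 * |β|) + b < 1) :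
    ∀ 𝓦 : PerturbationFamily 4 2, (∀ᶠ L : ℕ in atTop, IsFluxLocalW m s b (𝓦 L)) →
      ∀ μ ∈ perturbedLimitPoints β 𝓦,
        HasAreaLawWith μ (fun g => normalisedCharacter 2 (fundamentalRep (Fin 2) g)) 2
            (-Real.log (max (6 * (2 * |β|) + b) (1 / 2)) / (m * s)) ∧
        ((∃ σ : ℝ, HasStringTension μ (fun g => normalisedCharacter 2 (fundamentalRep (Fin 2) g)) σ) →
            -Real.log (max (6 * (2 * |β|) + b) (1 / 2)) / (m * s) ≤ suFundStringTension 2 μ) := by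
  intro 𝓦 h𝓦 μ hμ
  have h := stringTension_fluxLocalW (d := 4) (N := 2) (by norm_num) le_rfl (β := β) (b := b) hm hs (by push_cast; linarith)
    𝓦 h𝓦 μ hμ
  have e : (2 * ((4 - 1 : ℕ) : ℝ) * |β| * (2 : ℕ) + b) = 6 * (2 * |β|) + b := by push_cast; ring
  rw [e] at h
  refine ⟨h.1, fun ⟨σ, hσ⟩ => ?_⟩
  rw [suFundStringTension_def, hσ.stringTension_eq]
  exact h.2.1 σ hσ

end Summit.Ventures.YMGap.RobustBall

end
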